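import Literature.NumberTheory.GaloisCohomology.Howard2004.DVRSettingEngineLocalInputsOfUnitsProofs
import Literature.NumberTheory.GaloisCohomology.Howard2004.InertTameGeneratorRingClassProofs
import Literature.NumberTheory.GaloisCohomology.Howard2004.DVRSettingEngineRedProofs
import Literature.NumberTheory.GaloisCohomology.Howard2004.DVRSettingLevelTrivialityProofs
import Literature.NumberTheory.GaloisCohomology.Howard2004.DVRLevelSelmerFiniteProofs
import Literature.NumberTheory.GaloisCohomology.Howard2004.TowerMorphismPushforward
import HarnessLib

/-!
# Howard 2004, §1.4 display (2) on a `DVRSetting`: the local conditions `𝓕(n)` are COCARTESIAN along the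
# reductions `T^{(j)} ↠ T^{(i)}` at EVERY place — local Selmer lifts exist (proofs file)

Topic `NumberTheory/GaloisCohomology/Howard2004` (cell `pub/bsd-print-x9`, the cone of the cite-only leaf C45.1′
`prop141_casselsTate_skewPairing_atLevel` = Howard Prop. 1.4.1 / Flach; brick «C451-F0′ = LEVEL-EXACT»; seat
`bsd-line-x10b-p1-w2` g18).  THEOREMS ONLY: no definition, no named fact, no instance, no notation, no `sorry`.

SOURCE.  B. Howard, *The Heegner point Kolyvagin system*, Compositio Math. **140** (2004) 1439–1472 =
arXiv:1202.6340.  §1.4 (arXiv §2.4, p. 8 L22–30): «Hypothesis H.3 implies that for any positive integers `s` and `t`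
with `s + t ≤ k`, and any place `v` of `K`, there are exact sequences
(1) `0 → H¹_{/𝓕}(K_v, T/𝔪^tT) →ξ H¹_{/𝓕}(K_v, T/𝔪^{s+t}T) → H¹_{/𝓕}(K_v, T/𝔪^sT)`,
(2) `H¹_{𝓕*}(K_v, T*[𝔪^s]) → H¹_{𝓕*}(K_v, T*[𝔪^{s+t}]) →ξ H¹_{𝓕*}(K_v, T*[𝔪^t]) → 0`»; used at p. 8 L74–76:
«By the exact sequence (2) there is a `β'_v ∈ Z¹_{𝓕*}(K_v, T*[𝔪^{s+t}])` such that `π^s β'_v = b_v`» — the LOCAL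
SELMER LIFTS of Flach's construction (Morgan–Smith arXiv:2103.08530 Def. 3.2: «`E` exact in `SMod_𝓕`», i.e.
`ι⁻¹(𝒲) = 𝒲₁` and `π(𝒲) = 𝒲₂`).  Invoked in §1.6 ¶3 (p. 11 L33–44) for `(T^{(k)}, 𝓕(n))`, `n ∈ 𝓝^{(k)}`, through
Lemma 1.5.1 (p. 9 L127–133: «`(T, 𝓕(n), 𝓛(n))` satisfies H.0–H.5») and §1.2 (p. 6 L84–92: «the maximal `p`-subextension
`L` of `K[ℓ]_λ/K_λ` is a maximal totally tamely ramified abelian `p`-extension of `K_λ` whose Galois group is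
canonically identified with the `p`-Sylow subgroup of `G_ℓ`»).

WHAT IS PROVED (the `π`-direction = the cocartesian half; the `ι⁻¹`-direction = cartesian half is the one-step
`TransverseCartesianProofs.comap_incLoc_atLevel_cond_eq`, iterated and transported to abstract pinned transitions in the
companion `DVRSettingLevelConditionsCartesianProofs`, no guard).  On the `T`-side of H.4 (where `π^s : T*[𝔪^{s+t}] →
T*[𝔪^t]` reads as the reduction `red : T^{(j)} ↠ T^{(i)}`, `T* ≅ Tw(T)`):

* §1 (any field `F`, modules with TRIVIAL action, `Λ ≤ Γ_F` open normal with `Γ_F/Λ` cyclic on `σ₀`):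
  `eq_zero_of_resSubgroup_eq_zero_of_evalClass_eq_zero` — a class dying on `Λ` is determined by its value at `σ₀`;
  `evalClass_cohomologyMap` — evaluation is natural in the module;
  **`map_cohomologyMap_ker_resSubgroup_eq`** — for `f : N₁ ↠ N₂` SURJECTIVE (and every exponent `d` with `σ₀^d ∈ Λ`
  killing `N₁`), `H¹(f)` maps `ker(H¹(F,N₁) → H¹(Λ,N₁))` ONTO `ker(H¹(F,N₂) → H¹(Λ,N₂))` (existence of classes with
  prescribed value, `TransverseComplementOfCyclicProofs.exists_resSubgroup_eq_zero_and_evalClass_eq`).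
* §2 (Howard's `λ`, every imaginary quadratic `K` with **`p ∤ #𝓞_K^×`**):
  **`map_cohomologyMap_transverseCondition_eq_of_not_dvd_card_units`** — `H¹(f)(H¹_tr(K_λ, N₁)) = H¹_tr(K_λ, N₂)` for
  `f : N₁ ↠ N₂` equivariant, `Γ_{K_λ}` trivial on `N₁`, `N₁` `p`-primary with `(ℓ + 1)·N₁ = 0`.  The guard `p ∤ #𝓞_K^×`
  is Howard's «`L` maximal» (`#Gal(K[ℓ]_λ/K_λ) = (ℓ+1)/u_K`; REF-167 «How04-2.6.1@(3,−3)-units»): at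
  `(p, d_K) = (3, −3)` the statement can fail (`H¹_tr(K_λ, N) = N[3^{v₃(ℓ+1)−1}]`), cf. the cell's FINDING «hu axis»
  (x10b-p1-w7 g12 / lit g46, 2026-08-29).
* §3 (on a `DVRSetting` `S` with `S.SatisfiesH`, `hu`, levels `i ≤ j`, `↑n ⊆ S.levelPrimes j`):
  **`DVRSetting.map_redLELoc_atLevel_cond_eq`** — `(𝓕(n)_{j,v}).map H¹_v(redLE) = 𝓕(n)_{i,v}` at EVERY place `v`
  (off `n`: `cond_redLE`, no guard; at `λ ∈ n`: §2 with `Γ_{K_λ}` trivial on `T^{(j)}`,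
  `toLocal_apply_eq_self_of_subset_levelPrimes`); and the LIFT letter
  **`DVRSetting.exists_mem_atLevel_cond_redLELoc_eq_localization`** — for `a ∈ H¹_{𝓕(n)}(K, T^{(i)})` and every
  place `v` there is `ℓ_v ∈ 𝓕(n)_{j,v}` with `H¹_v(redLE) ℓ_v = loc_v a` (Howard's `β'_v`, read `T`-side); the variants
  `exists_mem_atLevel_cond_sub_mem_ker_redLELoc` / `exists_mem_atLevel_cond_redLELoc_eq_redLELoc_localization` for a
  global pre-image `ã` (`red ã = a`): the local DEFECTS `loc_v ã − ℓ_v ∈ ker H¹_v(redLE)` (the cell's LIFT-PT letter `hℓ`).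

HONEST FRAMING.  Pairing-free plumbing for a kernel port of Prop. 1.4.1 (the local Selmer lifts of Flach's /
Morgan–Smith's construction, and of the cell's «LIFT-PT» criterion); Prop. 1.4.1, Thm. 1.4.2, C45.1′/C45.1″,
`thm161_dvrKolyvaginBound` are NOT proved here; no summit statement is proved; BSD is not proved by any of this.

References: [Howard2004HeegnerKolyvagin] §1.2, §1.4 displays (1)(2), Lemma 1.5.1, §1.6 (arXiv:1202.6340 p. 6 L84–92,
p. 8 L22–30 and L74–76, p. 9 L127–133, p. 11 L33–44); [MazurRubinMemoirs2004] Lemma 1.2.1, Lemma 3.7.4;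
[GrossLMS1991] §3; [Cox2013] §7.D Thm. 7.24; [SerreGaloisCohomology1997] I §2.2, I §5.1.
-/

set_option autoImplicit false

noncomputable section

open Function NumberField IsDedekindDomain IsDedekindDomain.HeightOneSpectrum Field
open scoped NumberField

namespace Literature.NumberTheory.GaloisCohomology.Howard2004

open Literature.NumberTheory.GaloisRepresentations
open Literature.NumberTheory.GaloisRepresentations.DiscreteGaloisModule
open Literature.NumberTheory.EllipticCurves

/-! ## §1 Classes dying on `Λ` (trivial action, `Γ_F/Λ` cyclic on `σ₀`): rigidity and surjectivity of `H¹(f)` -/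

section Local

variable {F : Type} [Field F]
  {N₁ : Type} [AddCommGroup N₁] [TopologicalSpace N₁] [DiscreteTopology N₁]
  {N₂ : Type} [AddCommGroup N₂] [TopologicalSpace N₂] [DiscreteTopology N₂]

/-- **A class dying on `Λ` is determined by its value at `σ₀`** (trivial action, `Γ_F = ⋃_j σ₀^j Λ`): if
`res_Λ c = 0` and `c(σ₀) = 0` then `c = 0` — a representing cocycle is a homomorphism vanishing on `Λ` and at `σ₀`.
[cite: Howard2004HeegnerKolyvagin, Prop. 1.1.9 and §1.2 (arXiv:1202.6340 p. 6 L17–25, L84–92)]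
[cite: SerreGaloisCohomology1997, I §2.3 and I §5.1] -/
theorem eq_zero_of_resSubgroup_eq_zero_of_evalClass_eq_zero (ρ : DiscreteGaloisModule F N₁)
    (htriv : ∀ (σ : absoluteGaloisGroup F) (x : N₁), ρ σ x = x) (Λ : Subgroup (absoluteGaloisGroup F))
    (σ₀ : absoluteGaloisGroup F) (hcyc : ∀ σ : absoluteGaloisGroup F, ∃ j : ℕ, (σ₀ ^ j)⁻¹ * σ ∈ Λ)
    {c : galoisCohomology ρ 1} (hc : resSubgroup ρ.toTopRep Λ 1 c = 0)
    (h0 : evalClass ρ htriv σ₀ c = 0) : c = 0 := by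
  obtain ⟨z, rfl⟩ := oneCocycleClass_surjective ρ.toTopRep c
  obtain ⟨v, hv⟩ := (resSubgroup_oneCocycleClass_eq_zero_iff ρ.toTopRep Λ z).1 hc
  rw [evalClass_oneCocycleClass] at h0
  have hzΛ : ∀ h ∈ Λ, z.1 h = 0 := fun h hh => by
    rw [hv h hh, ContinuousRep.toTopRep_ρ_apply, htriv, sub_self]
  have hmul : ∀ g h : absoluteGaloisGroup F, z.1 (g * h) = z.1 g + z.1 h := fun g h => by
    rw [z.2 g h, ContinuousRep.toTopRep_ρ_apply, htriv]
  have hpow : ∀ j : ℕ, z.1 (σ₀ ^ j) = j • z.1 σ₀ := fun j => by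
    induction j with
    | zero => rw [pow_zero, zero_smul]; exact hzΛ 1 Λ.one_mem
    | succ j ih => rw [pow_succ, hmul, ih, succ_nsmul]
  have hz : ∀ σ : absoluteGaloisGroup F, z.1 σ = 0 := fun σ => by
    obtain ⟨j, hj⟩ := hcyc σ
    have hσ : σ = σ₀ ^ j * ((σ₀ ^ j)⁻¹ * σ) := (mul_inv_cancel_left _ _).symm
    rw [hσ, hmul, hzΛ _ hj, add_zero, hpow, h0, smul_zero]
  exact (oneCocycleClass_eq_zero_iff ρ.toTopRep z).2 ⟨0, fun g => by rw [hz, map_zero, sub_zero]⟩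

/-- **Evaluation is natural in the module**: `(H¹(f) c)(γ) = f (c(γ))` for an equivariant additive `f` between
modules with trivial action. [cite: Howard2004HeegnerKolyvagin, Prop. 1.1.7 (arXiv:1202.6340 p. 5 L137–141: functoriality of evaluation)] -/
theorem evalClass_cohomologyMap (ρ₁ : DiscreteGaloisModule F N₁) (ρ₂ : DiscreteGaloisModule F N₂)
    (htriv₁ : ∀ (σ : absoluteGaloisGroup F) (x : N₁), ρ₁ σ x = x)
    (htriv₂ : ∀ (σ : absoluteGaloisGroup F) (x : N₂), ρ₂ σ x = x) (f : N₁ →+ N₂)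
    (hf : ∀ (g : absoluteGaloisGroup F) (x : N₁), f (ρ₁ g x) = ρ₂ g (f x)) (γ : absoluteGaloisGroup F)
    (c : galoisCohomology ρ₁ 1) :
    evalClass ρ₂ htriv₂ γ (ContinuousRep.cohomologyMap ρ₁ ρ₂ f continuous_of_discreteTopology hf 1 c) =
      f (evalClass ρ₁ htriv₁ γ c) := by
  obtain ⟨z, rfl⟩ := oneCocycleClass_surjective ρ₁.toTopRep c
  rw [cohomologyMap_one_oneCocycleClass, evalClass_oneCocycleClass, evalClass_oneCocycleClass,
    contOneCocycles.pullback_apply]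
  rfl

/-- `H¹(f)` carries the classes dying on `Λ` into the classes dying on `Λ` (no hypothesis on the action).
[cite: SerreGaloisCohomology1997, I §5.1 and I §2.2] -/
theorem map_cohomologyMap_ker_resSubgroup_le (ρ₁ : DiscreteGaloisModule F N₁) (ρ₂ : DiscreteGaloisModule F N₂)
    (Λ : Subgroup (absoluteGaloisGroup F)) (f : N₁ →+ N₂)
    (hf : ∀ (g : absoluteGaloisGroup F) (x : N₁), f (ρ₁ g x) = ρ₂ g (f x)) :
    ((resSubgroup ρ₁.toTopRep Λ 1).hom.toLinearMap.toAddMonoidHom.ker).map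
        (ContinuousRep.cohomologyMap ρ₁ ρ₂ f continuous_of_discreteTopology hf 1) ≤
      (resSubgroup ρ₂.toTopRep Λ 1).hom.toLinearMap.toAddMonoidHom.ker := by
  rintro _ ⟨c, hc, rfl⟩
  exact resSubgroup_cohomologyMap_eq_zero ρ₁ ρ₂ f hf Λ hc

/-- **`H¹(f)` maps `ker(H¹(F, N₁) → H¹(Λ, N₁))` ONTO `ker(H¹(F, N₂) → H¹(Λ, N₂))` for `f : N₁ ↠ N₂` surjective**
(trivial actions; `Λ` open normal; `Γ_F/Λ` cyclic on the image of `σ₀`; every exponent `d` with `σ₀^d ∈ Λ` kills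
`N₁`): given a class `c₂` dying on `Λ`, lift its value `c₂(σ₀)` along `f`, realise the lift as the value of a class
`c₁` dying on `Λ` (`exists_resSubgroup_eq_zero_and_evalClass_eq`), and `H¹(f) c₁ = c₂` by rigidity.
[cite: Howard2004HeegnerKolyvagin, §1.4 display (2) with Prop. 1.1.9 and §1.2 (arXiv:1202.6340 p. 8 L22–30, p. 6 L17–25, L84–92)]
[cite: MazurRubinMemoirs2004, Lemma 1.2.1] -/
theorem map_cohomologyMap_ker_resSubgroup_eq (ρ₁ : DiscreteGaloisModule F N₁) (ρ₂ : DiscreteGaloisModule F N₂)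
    (htriv₁ : ∀ (σ : absoluteGaloisGroup F) (x : N₁), ρ₁ σ x = x)
    (htriv₂ : ∀ (σ : absoluteGaloisGroup F) (x : N₂), ρ₂ σ x = x)
    (Λ : Subgroup (absoluteGaloisGroup F)) [Λ.Normal] (hΛ : IsOpen (Λ : Set (absoluteGaloisGroup F)))
    (σ₀ : absoluteGaloisGroup F) (hcyc : ∀ σ : absoluteGaloisGroup F, ∃ j : ℕ, (σ₀ ^ j)⁻¹ * σ ∈ Λ)
    (f : N₁ →+ N₂) (hf : ∀ (g : absoluteGaloisGroup F) (x : N₁), f (ρ₁ g x) = ρ₂ g (f x))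
    (hsurj : Function.Surjective f) (hkill : ∀ d : ℕ, σ₀ ^ d ∈ Λ → ∀ x : N₁, d • x = 0) :
    ((resSubgroup ρ₁.toTopRep Λ 1).hom.toLinearMap.toAddMonoidHom.ker).map
        (ContinuousRep.cohomologyMap ρ₁ ρ₂ f continuous_of_discreteTopology hf 1) =
      (resSubgroup ρ₂.toTopRep Λ 1).hom.toLinearMap.toAddMonoidHom.ker := by
  refine le_antisymm (map_cohomologyMap_ker_resSubgroup_le ρ₁ ρ₂ Λ f hf) fun c₂ hc₂ => ?_
  have hc₂' : resSubgroup ρ₂.toTopRep Λ 1 c₂ = 0 := hc₂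
  obtain ⟨t₁, ht₁⟩ := hsurj (evalClass ρ₂ htriv₂ σ₀ c₂)
  obtain ⟨c₁, hc₁, hev⟩ := exists_resSubgroup_eq_zero_and_evalClass_eq ρ₁ htriv₁ Λ hΛ σ₀ hcyc t₁
    (fun d hd => hkill d hd t₁)
  refine ⟨c₁, hc₁, sub_eq_zero.1 ?_⟩
  -- the difference dies on `Λ` and vanishes at `σ₀`, hence is zero
  refine eq_zero_of_resSubgroup_eq_zero_of_evalClass_eq_zero ρ₂ htriv₂ Λ σ₀ hcyc
    (c := ContinuousRep.cohomologyMap ρ₁ ρ₂ f continuous_of_discreteTopology hf 1 c₁ - c₂) ?_ ?_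
  · exact (resSubgroup ρ₂.toTopRep Λ 1).hom.toLinearMap.toAddMonoidHom.ker.sub_mem
      (resSubgroup_cohomologyMap_eq_zero ρ₁ ρ₂ f hf Λ hc₁) hc₂'
  · refine ((evalClass ρ₂ htriv₂ σ₀).map_sub _ _).trans (sub_eq_zero.2 ?_)
    exact (evalClass_cohomologyMap ρ₁ ρ₂ htriv₁ htriv₂ f hf σ₀ c₁).trans (by rw [hev, ht₁])

end Local

/-! ## §2 Howard's transverse condition is cocartesian along surjections, `p ∤ #𝓞_K^×` -/

section Transverse

variable {K : Type} [Field K] [NumberField K] (p : ℕ) [Fact p.Prime]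
  {M₁ : Type} [AddCommGroup M₁] [TopologicalSpace M₁] [DiscreteTopology M₁]
  {M₂ : Type} [AddCommGroup M₂] [TopologicalSpace M₂] [DiscreteTopology M₂]

/-- **`H¹(f)(H¹_tr(K_λ, N₁)) = H¹_tr(K_λ, N₂)` for a surjection `f : N₁ ↠ N₂`** at an inert `λ ∋ ℓ` of an imaginary
quadratic `K` with `p ∤ #𝓞_K^×`, for finite `p`-primary modules with trivial `Γ_{K_λ}`-action and `(ℓ + 1)·N₁ = 0`:
Howard's exact sequence (2) of §1.4 at a prime of `n`, read on the `T`-side («`π(𝒲) = 𝒲₂`» for the transverse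
slot).  `H¹_tr = ker(res to Γ_{K_λ} ∩ Γ_{K[ℓ]})` for `p`-primary modules, `Γ_{K_λ}/(Γ_{K_λ} ∩ Γ_{K[ℓ]})` is cyclic on
a tame generator `σ₀`, and `σ₀^d ∈ Γ_{K[ℓ]} ⇒ #G_ℓ ∣ d ⇒ d` kills `N₁` (`#G_ℓ · N₁ = 0` from `ℓ + 1 ∣ #G_ℓ · #𝓞_K^×`
and `p ∤ #𝓞_K^×` — Howard's «`L` is maximal», false at `(p, d_K) = (3, −3)`).
[cite: Howard2004HeegnerKolyvagin, §1.4 display (2), §1.2 and Lemma 1.5.1 (arXiv:1202.6340 p. 8 L22–30, p. 6 L84–92, p. 9 L127–133)]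
[cite: Cox2013, §7.D Thm. 7.24] -/
theorem map_cohomologyMap_transverseCondition_eq_of_not_dvd_card_units [Finite M₁] [Finite M₂]
    (hK : IsImaginaryQuadratic K) (hu : ¬ p ∣ Nat.card (𝓞 K)ˣ)
    (τ₁ : DiscreteGaloisModule K M₁) (τ₂ : DiscreteGaloisModule K M₂)
    (jbar : AlgebraicClosure K →+* ℂ) {ℓ : ℕ} (hℓ : ℓ.Prime) (hℓP : (Ideal.span {(ℓ : 𝓞 K)}).IsPrime)
    {v : HeightOneSpectrum (𝓞 K)} (hv : (ℓ : 𝓞 K) ∈ v.asIdeal) (f : M₁ →+ M₂)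
    (hf : ∀ (g : absoluteGaloisGroup K) (x : M₁), f (τ₁ g x) = τ₂ g (f x)) (hsurj : Function.Surjective f)
    (htriv₁ : ∀ (g : absoluteGaloisGroup (v.adicCompletion K)) (x : M₁), GaloisRep.toLocal v τ₁ g x = x)
    (htriv₂ : ∀ (g : absoluteGaloisGroup (v.adicCompletion K)) (x : M₂), GaloisRep.toLocal v τ₂ g x = x)
    (hp₁ : ∀ x : M₁, ∃ n : ℕ, p ^ n • x = 0) (hp₂ : ∀ x : M₂, ∃ n : ℕ, p ^ n • x = 0)
    (hℓT : ∀ x : M₁, (ℓ + 1) • x = 0) :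
    (transverseCondition p τ₁ ℓ jbar v).map
        (ContinuousRep.cohomologyMap (τ₁.toLocal (Sum.inr v)) (τ₂.toLocal (Sum.inr v)) f
          continuous_of_discreteTopology (fun _ y => hf _ y) 1) =
      transverseCondition p τ₂ ℓ jbar v := by
  obtain ⟨σ₀, hσ₀⟩ := exists_isTameGenerator (F := v.adicCompletion K)
  haveI := localRingClassSubgroup_normal hK jbar hℓ.ne_zero v
  have hGexp := fun g hg =>
    pow_residueFieldCard_sub_one_eq_one_of_mem_ringClassGalOver_of_isImaginaryQuadratic hK
      (jbar.comp (algebraMap K (AlgebraicClosure K))) hℓ hℓP hv (g := g) hg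
  have hcyc := exists_pow_inv_mul_mem_localRingClassSubgroup_of_isTameGenerator hK jbar hℓ hℓP hv hσ₀ hGexp
  have hkill : ∀ d : ℕ, (σ₀ : absoluteGaloisGroup (v.adicCompletion K)) ^ d ∈ localRingClassSubgroup ℓ jbar v →
      ∀ x : M₁, d • x = 0 := fun d hd x => by
    obtain ⟨k, hk⟩ := natCard_ringClassGalOver_dvd_of_pow_mem hK jbar hℓ hℓP hv hσ₀ hGexp hd
    rw [hk, mul_smul]
    exact natCard_ringClassGalOver_smul_eq_zero_of_not_dvd_card_units p hK hu _ hℓ hℓP hp₁ hℓT (k • x)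
  rw [transverseCondition_eq_ker_resSubgroup_localRingClassSubgroup p τ₁ ℓ jbar v htriv₁ hp₁,
    transverseCondition_eq_ker_resSubgroup_localRingClassSubgroup p τ₂ ℓ jbar v htriv₂ hp₂]
  exact map_cohomologyMap_ker_resSubgroup_eq (GaloisRep.toLocal v τ₁) (GaloisRep.toLocal v τ₂) htriv₁ htriv₂
    (localRingClassSubgroup ℓ jbar v) (isOpen_localRingClassSubgroup hK jbar hℓ.ne_zero v) σ₀ hcyc f
    (fun g y => hf _ y) hsurj hkill

end Transverse

/-! ## §3 On a `DVRSetting`: `𝓕(n)` is cocartesian along `T^{(j)} ↠ T^{(i)}` at every place; local Selmer lifts -/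

namespace DVRSetting

variable {p : ℕ} [Fact p.Prime] {K : Type} [Field K] [NumberField K]
  {R : Type} [CommRing R] [IsDomain R] [IsDiscreteValuationRing R] [Algebra ℤ_[p] R]
  {N : ℕ → Type} [∀ k, AddCommGroup (N k)] [∀ k, TopologicalSpace (N k)]
  [∀ k, DiscreteTopology (N k)] [∀ k, Module R (N k)]
  {Rk : ℕ → Type} [∀ k, CommRing (Rk k)] [∀ k, IsLocalRing (Rk k)] [∀ k, TopologicalSpace (Rk k)]
  [∀ k, DiscreteTopology (Rk k)] [∀ k, Algebra ℤ_[p] (Rk k)] [∀ k, Algebra R (Rk k)]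
  [∀ k, Module (Rk k) (N k)] [∀ k, IsScalarTower R (Rk k) (N k)]
  {Nbar : Type} [AddCommGroup Nbar] [TopologicalSpace Nbar] [DiscreteTopology Nbar]
  [∀ k, Module (Rk k) Nbar]
  {Nq : ℕ → Finset (HeightOneSpectrum (𝓞 K)) → Type} [∀ k n, AddCommGroup (Nq k n)]
  [∀ k n, TopologicalSpace (Nq k n)] [∀ k n, DiscreteTopology (Nq k n)]
  [∀ k n, Module (Rk k) (Nq k n)] [∀ k n, Module R (Nq k n)]
  [∀ k n, IsScalarTower R (Rk k) (Nq k n)]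

/-- **The transverse slot at `λ ∈ n ⊆ 𝓛^{(j)}` is cocartesian along `T^{(j)} ↠ T^{(i)}`** (`i ≤ j`, `p ∤ #𝓞_K^×`):
`(H¹_tr(K_λ, T^{(j)})).map H¹_λ(redLE) = H¹_tr(K_λ, T^{(i)})` — §2 with `Γ_{K_λ}` trivial on `T^{(j)}`, `T^{(i)}`
(`toLocal_apply_eq_self_of_subset_levelPrimes`) and `(ℓ + 1)·T^{(j)} = 0` (`residueChar_succ_smul_eq_zero_of_mem_levelPrimes`).
[cite: Howard2004HeegnerKolyvagin, §1.4 display (2), Lemma 1.5.1 and §1.6 (arXiv:1202.6340 p. 8 L22–30, p. 9 L127–133, p. 11 L33–44)] -/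
theorem map_redLELoc_transverseCondition_eq (S : DVRSetting p K R N Rk Nbar Nq) (hy : S.SatisfiesH)
    (hu : ¬ p ∣ Nat.card (𝓞 K)ˣ) {i j : ℕ} (h : i ≤ j) {n : Finset (HeightOneSpectrum (𝓞 K))}
    (hn : ↑n ⊆ S.levelPrimes j) {w : HeightOneSpectrum (𝓞 K)} (hw : w ∈ n) :
    (transverseCondition p (S.T.ρ j) (residueChar w) S.jbar w).map (S.redLELoc h (Sum.inr w)) =
      transverseCondition p (S.T.ρ i) (residueChar w) S.jbar w := by
  haveI : Finite (N j) := S.finite_level hy j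
  haveI : Finite (N i) := S.finite_level hy i
  have hwj : w ∈ S.levelPrimes j := hn (Finset.mem_coe.mpr hw)
  have hni : ↑n ⊆ S.levelPrimes i := hn.trans (S.levelPrimes_antitone hy h)
  exact map_cohomologyMap_transverseCondition_eq_of_not_dvd_card_units p hy.imagQuad hu (S.T.ρ j) (S.T.ρ i)
    S.jbar (prime_residueChar w) (isPrime_span_residueChar_of_isDegreeTwo hy.imagQuad.1 (S.isDegreeTwo_of_mem_L hy hwj.1))
    (natCast_residueChar_mem_asIdeal w) (S.T.redLE h).toAddMonoidHom (fun g x => S.T.redLE_equivariant h g x)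
    (S.T.redLE_surjective h)
    (fun g x => S.toLocal_apply_eq_self_of_subset_levelPrimes hy hn hw g x)
    (fun g x => S.toLocal_apply_eq_self_of_subset_levelPrimes hy hni hw g x)
    (S.exists_pow_p_smul_eq_zero_level hy j) (S.exists_pow_p_smul_eq_zero_level hy i)
    (S.residueChar_succ_smul_eq_zero_of_mem_levelPrimes hy hwj)

/-- **Howard §1.4 display (2) for `𝓕(n)` on a `DVRSetting`, `T`-side: the local conditions of `𝓕(n)` reduce ONTO each
other along `T^{(j)} ↠ T^{(i)}` at EVERY place** (`i ≤ j`, `n ⊆ 𝓛^{(j)}`, `p ∤ #𝓞_K^×`):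
`(𝓕(n)_{j,v}).map H¹_v(redLE) = 𝓕(n)_{i,v}`.  Off `n` this is `cond_redLE` (the conditions `𝓕` are propagated from
`T`, no guard); at `λ ∈ n` it is the transverse slot (`map_redLELoc_transverseCondition_eq`).
[cite: Howard2004HeegnerKolyvagin, §1.4 display (2), Def. 1.2.2, Lemma 1.5.1 and §1.6 (arXiv:1202.6340 p. 8 L22–30, p. 6 L101–125, p. 9 L127–133, p. 11 L33–44)] -/
theorem map_redLELoc_atLevel_cond_eq (S : DVRSetting p K R N Rk Nbar Nq) (hy : S.SatisfiesH)
    (hu : ¬ p ∣ Nat.card (𝓞 K)ˣ) {i j : ℕ} (h : i ≤ j) {n : Finset (HeightOneSpectrum (𝓞 K))}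
    (hn : ↑n ⊆ S.levelPrimes j) (v : Place K) :
    (((S.t j).atLevel S.jbar n).cond v).map (S.redLELoc h v) = ((S.t i).atLevel S.jbar n).cond v := by
  rcases v with w | w
  · rw [(S.t j).atLevel_cond_inl, (S.t i).atLevel_cond_inl]
    exact S.cond_redLE hy h (Sum.inl w)
  · by_cases hw : w ∈ n
    · rw [(S.t j).atLevel_cond_inr_of_mem S.jbar hw, (S.t i).atLevel_cond_inr_of_mem S.jbar hw]
      exact S.map_redLELoc_transverseCondition_eq hy hu h hn hw
    · rw [(S.t j).atLevel_cond_inr_of_not_mem S.jbar hw, (S.t i).atLevel_cond_inr_of_not_mem S.jbar hw]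
      exact S.cond_redLE hy h (Sum.inr w)

/-- **`H¹_v(redLE)` carries `𝓕(n)_{j,v}` into `𝓕(n)_{i,v}`** (the `⊆` half, no unit hypothesis: `cond_redLE` off `n`,
functoriality of the transverse slot at `λ ∈ n`).
[cite: Howard2004HeegnerKolyvagin, Def. 1.2.2 and §1.6 (arXiv:1202.6340 p. 6 L101–125, p. 11 L33–44)] -/
theorem map_redLELoc_atLevel_cond_le (S : DVRSetting p K R N Rk Nbar Nq) (hy : S.SatisfiesH) {i j : ℕ}
    (h : i ≤ j) (n : Finset (HeightOneSpectrum (𝓞 K))) (v : Place K) :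
    (((S.t j).atLevel S.jbar n).cond v).map (S.redLELoc h v) ≤ ((S.t i).atLevel S.jbar n).cond v := by
  rcases v with w | w
  · rw [(S.t j).atLevel_cond_inl, (S.t i).atLevel_cond_inl]
    exact (S.cond_redLE hy h (Sum.inl w)).le
  · by_cases hw : w ∈ n
    · rw [(S.t j).atLevel_cond_inr_of_mem S.jbar hw, (S.t i).atLevel_cond_inr_of_mem S.jbar hw]
      rintro _ ⟨c, hc, rfl⟩
      exact cohomologyMap_mem_transverseCondition (S.T.ρ j) (S.T.ρ i) (S.T.redLE h).toAddMonoidHom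
        (fun g x => S.T.redLE_equivariant h g x) (residueChar w) S.jbar w hc
    · rw [(S.t j).atLevel_cond_inr_of_not_mem S.jbar hw, (S.t i).atLevel_cond_inr_of_not_mem S.jbar hw]
      exact (S.cond_redLE hy h (Sum.inr w)).le

/-- **The local Selmer lifts (Howard's `β'_v`, `T`-side)**: for `a ∈ H¹_{𝓕(n)}(K, T^{(i)})`, `i ≤ j`, `n ⊆ 𝓛^{(j)}`,
`p ∤ #𝓞_K^×`, at every place `v` there is `ℓ_v ∈ 𝓕(n)_{j,v} ≤ H¹(K_v, T^{(j)})` with `H¹_v(redLE) ℓ_v = loc_v a` — «by the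
exact sequence (2) there is a `β'_v ∈ Z¹_{𝓕*}(K_v, T*[𝔪^{s+t}])` such that `π^s β'_v = b_v`».
[cite: Howard2004HeegnerKolyvagin, §1.4 (arXiv:1202.6340 p. 8 L74–76) with display (2) (p. 8 L22–30)] -/
theorem exists_mem_atLevel_cond_redLELoc_eq_localization (S : DVRSetting p K R N Rk Nbar Nq)
    (hy : S.SatisfiesH) (hu : ¬ p ∣ Nat.card (𝓞 K)ˣ) {i j : ℕ} (h : i ≤ j)
    {n : Finset (HeightOneSpectrum (𝓞 K))} (hn : ↑n ⊆ S.levelPrimes j)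
    {a : galoisCohomology (S.T.ρ i) 1} (ha : a ∈ (((S.t i).atLevel S.jbar n).cond).selmerGroup)
    (v : Place K) :
    ∃ ℓv ∈ ((S.t j).atLevel S.jbar n).cond v,
      S.redLELoc h v ℓv = galoisCohomology.localization (S.T.ρ i) v 1 a := by
  have hav : galoisCohomology.localization (S.T.ρ i) v 1 a ∈ ((S.t i).atLevel S.jbar n).cond v :=
    (SelmerStructure.mem_selmerGroup_iff _ _).1 ha v
  rw [← S.map_redLELoc_atLevel_cond_eq hy hu h hn v] at hav
  obtain ⟨ℓv, hℓv, heq⟩ := hav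
  exact ⟨ℓv, hℓv, heq⟩

/-- **A global class reducing to `a`, read locally**: if `red ã = a` for `ã ∈ H¹(K, T^{(j)})` then at every place
`loc_v ã − ℓ_v ∈ ker H¹_v(redLE)` for the local Selmer lift `ℓ_v ∈ 𝓕(n)_{j,v}` — the local DEFECTS of a global lift
(the `m_v` of the cell's LIFT-PT criterion live in this kernel `= H¹_v(inc^{j-i})(H¹(K_v, T^{(j-i-1)}))`-image).
[cite: Howard2004HeegnerKolyvagin, §1.4 (arXiv:1202.6340 p. 8 L66–80: «α_v», «β'_v», «the cochain α_v ∪ β'_v − ε_v»)] -/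
theorem exists_mem_atLevel_cond_sub_mem_ker_redLELoc (S : DVRSetting p K R N Rk Nbar Nq)
    (hy : S.SatisfiesH) (hu : ¬ p ∣ Nat.card (𝓞 K)ˣ) {i j : ℕ} (h : i ≤ j)
    {n : Finset (HeightOneSpectrum (𝓞 K))} (hn : ↑n ⊆ S.levelPrimes j)
    {a : galoisCohomology (S.T.ρ i) 1} (ha : a ∈ (((S.t i).atLevel S.jbar n).cond).selmerGroup)
    {a' : galoisCohomology (S.T.ρ j) 1} (hred : S.redLEH1 h a' = a) (v : Place K) :
    ∃ ℓv ∈ ((S.t j).atLevel S.jbar n).cond v,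
      galoisCohomology.localization (S.T.ρ j) v 1 a' - ℓv ∈ (S.redLELoc h v).ker := by
  obtain ⟨ℓv, hℓv, heq⟩ := S.exists_mem_atLevel_cond_redLELoc_eq_localization hy hu h hn ha v
  refine ⟨ℓv, hℓv, ?_⟩
  rw [AddMonoidHom.mem_ker, map_sub, heq, ← hred, S.localization_redLEH1 h v a', sub_self]

/-- The lift letter in the shape of a GLOBAL pre-image: if `ã ∈ H¹(K, T^{(j)})` reduces to an `𝓕(n)`-Selmer class
`red ã ∈ H¹_{𝓕(n)}(K, T^{(i)})`, then at every place `loc_v ã` and some `ℓ_v ∈ 𝓕(n)_{j,v}` have the same image under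
`H¹_v(redLE)` (the hypothesis `hℓ` of the cell's LIFT-PT criterion).
[cite: Howard2004HeegnerKolyvagin, §1.4 (arXiv:1202.6340 p. 8 L66–76)] -/
theorem exists_mem_atLevel_cond_redLELoc_eq_redLELoc_localization (S : DVRSetting p K R N Rk Nbar Nq)
    (hy : S.SatisfiesH) (hu : ¬ p ∣ Nat.card (𝓞 K)ˣ) {i j : ℕ} (h : i ≤ j)
    {n : Finset (HeightOneSpectrum (𝓞 K))} (hn : ↑n ⊆ S.levelPrimes j)
    {a' : galoisCohomology (S.T.ρ j) 1} (ha' : S.redLEH1 h a' ∈ (((S.t i).atLevel S.jbar n).cond).selmerGroup)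
    (v : Place K) :
    ∃ ℓv ∈ ((S.t j).atLevel S.jbar n).cond v,
      S.redLELoc h v ℓv = S.redLELoc h v (galoisCohomology.localization (S.T.ρ j) v 1 a') := by
  obtain ⟨ℓv, hℓv, heq⟩ := S.exists_mem_atLevel_cond_redLELoc_eq_localization hy hu h hn ha' v
  exact ⟨ℓv, hℓv, by rw [heq, S.localization_redLEH1 h v a']⟩

end DVRSetting

end Literature.NumberTheory.GaloisCohomology.Howard2004

end
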